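import Summits.CriticalPhenomena.PercolationContinuityZ3.Theorems.Transplant.SkelPhiForcedRunKitClauseC
import Summits.CriticalPhenomena.PercolationContinuityZ3.Theorems.Transplant.SkelPhiRunKitsG
import HarnessLib

/-!
(R-35)/J12 successor `…C` of `SkelPhiRunKitsF` (hp-8 g40, 2026-08-23): the forced kit is RE-CENTRED AT THE COLUMN END (p1-g17's `kitClauseFC` /
`kitClause_runXFC/YFC` / `kitClause_frameFC` / `kitClause_rootFrameFC`, binder list lane 03:18:28Z): the fat-prism rows `hkz / hRk· / hΛcyl` (and `hfr / hκ`,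
which only fed them) and the column row `hcol` are GONE (`ctCtr ↦ ctColEnd`, `ψ_ctColEnd_mem_Icc` / `ctColEnd_reach`, SkelPhiForcedColumnPlace); every other
binder and the proof body are verbatim — mentions of those rows below describe the superseded `SkelPhiRunKitsF`.

# N2 (frames-only node), (S0) kit tier, (F) spine part 4 (hp-8 g39): **THE FORCED KIT CLAUSES OF x-RUN / y′-RUN LEVELS FROM THE LONG LINKS AT
# EVERY CENTRE** (`Skelφ.hkits_runXFC` / `Skelφ.hkits_runYFC`) — the (S0) twins of p1-g11's `hkits_runXG`/`hkits_runYG` (SkelPhiRunKitsG) and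
# `hkits_runX'`/`hkits_runY'` (SkelPhiRunKitsPM): `hkits` of p1-g16's assembler `kitsAt_stepAFF` for level `j` of step `k` of the run schedules
# `xRunSched`/`yRunSched` read in the run frames `runX`/`runY`, from p1-g16's `kitClause_runXFC`/`kitClause_runYFC` (p339498): FAR contacts land in the
# target through the window rim; NEAR contacts get the route datum `routeSetsN_x`/`routeSetsN_y` from the LONG link at the kit centre at accuracy `δ³`

NON-VACUITY (lead g11 STANDING ORDER 2026-08-23T03:52:56Z (2)(b)): this file only THREADS its window / region / zone rows to p1-g17's re-centred
kit clause (`kitClauseFC` family, whose kept rows `hRg/hΛRg/hzconn/hcz/hDρ/hKCmax` have the witness `Λc := cylBallFin c kz R`, `Rg := Λc`,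
`Rs :=` its graph extent — p1-g17 03:09:30Z / (R-35) (3)); the FULL binder set of the theorems below is instantiated JOINTLY, at the closed terms of
record, by the (F) wrapper `faceHoldsRNQFnLT_frmChoiceAllQ3` (stmt-g20's Face params/glue twins over `KS0.kit0_ok` SkelFrmBChoiceNums p347587,
`hlong_of_atQ3/hlongY_of_atQ3` SkelFrmBChoiceLinks p351172, hp-8's SkelPhiCellsRoomsS/RootRoomsS) — non-vacuity: discharged jointly by that wrapper.
builds on p205010 (kernel theorem, internal audit signed; external expert review pending) — nothing in this file uses p205010; nothing here is a
claim about the open node `SamePDropOfSkeletonFrm₁`.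
Lane `prim-bschramm`, seat `prim-hp-8` (gen 39; junction file of the (F) spine, typed for p1's kit layer per hp-8 g39 19:46:40Z); helper file
(`--supports stmt-CriticalPhenomena-4575 --as helper`); F-PORT-JUNCTIONS (hp-8 g37).
Port rule ((S0), p1-g16 19:34:49Z): binders of `hkits_runXG/YG` minus `hd1/hD1/hD2/hℓ/hW/hKmax/hR'/hT`, the zone rows `hkn/hΛ/hZ/hMz`, the
pieces `Pex/hPex` and the estimates `hzone/hexit`; plus `hdD` and the zone datum's rows `hΛRg/hzconn/hcz` and the fat-prism rows `hkz/hRk/hΛcyl` (discharging `hcol` by `ctColEnd_mem_cylBallFin`); `hlong` at `1 − δ³`; conclusion =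
the per-level clause of `TStep.KitsAtF`.
* **`hkits_runXFC`**, **`hkits_runYFC`**.
[cite: KozmaNitzan2024, §4 Lemma 10, Steps III–IV (pp. 19–21); Lemma 11 (pp. 22–23)] [cite: MartineauTassion2017, §4.3 Lemma 4.2]
-/

noncomputable section

open scoped Classical

namespace Summit.CriticalPhenomena.PercolationContinuityZ3.Theorems.Transplant

namespace Skelφ

open MeasureTheory
open Literature.Probability.Percolation Literature.Probability.LatticeModels SimpleGraph KNLevels
open Literature.Barriers.CriticalPhenomena (graphBall graphBall_finite mem_graphBall_self graphBall_mono)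
open Skel (winGraph winGraph_adj winGraph_le winGraphIn winGraphIn_le KitGeom)
open Literature.Probability.Percolation.KozmaNitzan.Cells (oth oth_ne eq_oth_of_ne oth_oth)
open SkelI (tanOff tanTgt tanTgt_mem)

variable {V : Type} [DecidableEq V] {G : SimpleGraph V} [G.LocallyFinite] {ψ φ : V → Site 2}

/-- **THE FORCED KIT CLAUSE OF AN x-RUN LEVEL FROM THE LONG LINKS AT EVERY CENTRE** (`hkits` of `kitsAt_stepAFF` at level `j` of step `k`;
the (S0) twin of `hkits_runXG`/`hkits_runX'`): the window is the run frame `runX φ c₀ n_L h_L σ` around `w₀` (radius `R`), the level box is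
`[lo k − j, hi k + j]` of `xRunSched n_L ℓ_L h_L R′ qB Nr`, the region `Dr ⊇ Win(region k)` carries the subbox weighting `Wt`, the target
`T ⊇ Win(core (k+1)) ∪ (far part of the level)`; the zone datum `Λc c kz` at the kit centres (inside `Rg c`, connected from `c`, `c ∈ Λc c kz`,
containing the forced column's end); input at every centre `c`: the LONG x-links for `τ = ±1` at accuracy `δ³` (route datum by p1-g11's
`routeSetsN_x`). No zone estimate, no exit pieces ((S0): the kit's own seed box is forced).
[cite: KozmaNitzan2024, §4 Lemma 10 (pp. 17–21)] [cite: MartineauTassion2017, §4.3 Lemma 4.2] [this work] -/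
theorem hkits_runXFC [Countable V] (hlipφ : Lip G φ) (hstep : Steps G φ) {Δ : ℕ} (hΔ : ∀ v, G.degree v ≤ Δ) {q : unitInterval} {δ : ℝ} (hδ : 0 < δ)
    -- the run: long data, frame, schedule
    {nL : ℕ} (hnL : 1 ≤ nL) (c₀ : V) (hL : ℤ) {σ : ℤ} (hσ : σ = 1 ∨ σ = -1) {kq : ℕ} (hκL : hL.natAbs ≤ kq * nL) (ℓL R's qB Nr : ℕ)
    {k j : ℕ} {w₀ : V} {R r Rl : ℕ}
    -- kit constants
    (P : ApronPrm) {Mz Rs KCmax rs cS cU : ℕ} (hPN : kq + 3 ≤ P.N) (hA : P.A = (Mz + 1 : ℕ) * (shearUnit nL hL : ℤ) + 1)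
    (hdD : P.d + 2 ≤ shellD P) (hDρ : Rs + 1 ≤ shellD P) (hKCmax : (shellD P + Mz + 1) * (kq + 1) ≤ KCmax)
    (hwide : ∀ i, ((xRunSched nL ℓL hL R's qB Nr).lo k - (j : Site 2)) i + 2 * tanOff P.ℓs P.M ≤ ((xRunSched nL ℓL hL R's qB Nr).hi k + (j : Site 2)) i)
    (hdw : ∀ i, ((xRunSched nL ℓL hL R's qB Nr).lo k - (j : Site 2)) i + (P.d + 2 : ℕ) ≤ ((xRunSched nL ℓL hL R's qB Nr).hi k + (j : Site 2)) i)
    (hDw : ∀ i, ((xRunSched nL ℓL hL R's qB Nr).lo k - (j : Site 2)) i + ((shellD P + 1 + P.d + KCmax + Rs : ℕ) : ℤ) ≤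
      ((xRunSched nL ℓL hL R's qB Nr).hi k + (j : Site 2)) i)
    (hT : (shellD P : ℤ) + KCmax + Rs ≤ tanOff P.ℓs P.M)
    (hr₀ : P.N * (tanOff P.ℓs P.M + 2) + P.N * P.d + (KCmax + Rs) ≤ P.r₀) (hR : P.r₀ ≤ R)
    (hrs : 1 + (P.N * (tanOff P.ℓs P.M + 2) + P.N * P.d + (KCmax + Rs)) ≤ rs)
    (hcS : (P.N + 1) * (tanOff P.ℓs P.M + 1) + (P.N + 1) * P.d + (KCmax + 1) + cU ≤ cS)
    -- the reach of the kit centre: inside the `R′`-enlargement, and `B(w₀, R − r)` with `Rl ≤ r ≤ R`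
    (hE : j + (P.N * (tanOff P.ℓs P.M + 1) + P.N * P.d + KCmax) ≤ (xRunSched nL ℓL hL R's qB Nr).R')
    (hreach : r + (P.N * (tanOff P.ℓs P.M + 1) + P.N * P.d + KCmax) ≤ P.r₀) (hr : Rl ≤ r) (hrR : r ≤ R)
    -- the short region and the zone datum at the kit centres (inside `Rg`, connected from the centre inside itself, containing the centre
    -- and the fat-prism zone box of record `cylBallFin c kz Rk`, `Rk ≥ cylRadMax types kz (2·KCmax)` — whence the forced column's end)
    (Rg : V → Finset V) (hRg : ∀ c, ∀ u ∈ Rg c, u ∈ graphBall G c Rs) (hRgcard : ∀ c, (Rg c).card ≤ cU) (hcU1 : 1 ≤ cU)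
    (Λc : V → ℕ → Finset V) (kz : ℕ) (hΛRg : ∀ c, Λc c kz ⊆ Rg c) (hzconn : ∀ c, ∀ s ∈ Λc c kz, PathIn G (↑(Λc c kz) : Set V) c s)
    (hcz : ∀ c, c ∈ Λc c kz)


    -- the level's source/support, the weighting on the region, the target
    (kk : ℕ) (o : V) (Sfin : Finset V) {Wt : Sym2 V → unitInterval} {Dr T : Finset V} (hWD : IsSubbox (winGraph G w₀ R) Wt q Dr)
    (hPD : Win G (runX φ c₀ nL hL σ) w₀ ((xRunSched nL ℓL hL R's qB Nr).region k) R ⊆ Dr)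
    (hXD : winLevel G (runX φ c₀ nL hL σ) w₀ R ((xRunSched nL ℓL hL R's qB Nr).lo k) ((xRunSched nL ℓL hL R's qB Nr).hi k) j ⊆ Dr)
    (hPT : Win G (runX φ c₀ nL hL σ) w₀ ((xRunSched nL ℓL hL R's qB Nr).core (k + 1)) R ⊆ T)
    (hfarT : ∀ v ∈ winLevel G (runX φ c₀ nL hL σ) w₀ R ((xRunSched nL ℓL hL R's qB Nr).lo k) ((xRunSched nL ℓL hL R's qB Nr).hi k) j,
      v ∉ graphBall G w₀ (R - P.r₀) → v ∈ T)
    {N : ℕ} (hN : kk * (Δ + 1) ^ (2 * rs) ≤ N) (hk : (1 - (q : ℝ) ^ (1 + Δ * cS + cS * cU)) ^ kk ≤ δ)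
    -- THE INPUT AT EVERY CENTRE: the long links at accuracy `δ³`
    (hlong : ∀ c (τ : ℤ), τ = 1 ∨ τ = -1 → 1 - δ ^ 3 < (bondPercolation G q).real
      (linkIn (pgramPrism G φ c nL hL (3 * ℓL) Rl) (Λc c kz) (pgSideHalfW G φ c nL hL ℓL Rl σ (σ * τ)))) :
    ∃ (σ' : SData V) (S : Finset V),
      SHyp (winLData G (runX φ c₀ nL hL σ) w₀ R ((xRunSched nL ℓL hL R's qB Nr).lo k) ((xRunSched nL ℓL hL R's qB Nr).hi k) o Sfin) j σ' ∧
      σ'.N ≤ N ∧ (1 - (q : ℝ) ^ σ'.sB) ^ σ'.k ≤ δ ∧ S ⊆ Dr ∧ (∀ x ∈ σ'.K, σ'.face x ⊆ S) ∧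
      RelayClause (winLData G (runX φ c₀ nL hL σ) w₀ R ((xRunSched nL ℓL hL R's qB Nr).lo k) ((xRunSched nL ℓL hL R's qB Nr).hi k) o Sfin) Wt j σ' S T Dr δ := by
  set SN := xRunSched nL ℓL hL R's qB Nr with hSN
  set ψ := runX φ c₀ nL hL σ with hψ
  set SF := runXSideU (φ := φ) c₀ hnL hL hσ (SN.lo k - (j : Site 2)) (SN.hi k + (j : Site 2)) with hSF
  have hKeq : winLevel G ψ w₀ R (SN.lo k) (SN.hi k) j = Win G ψ w₀ (Finset.Icc (SN.lo k - (j : Site 2)) (SN.hi k + (j : Site 2))) R := rfl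
  -- the frame facts used for the reach
  have hlip : Lip G ψ := lip_runX hlipφ hσ hnL c₀ hL
  have hq : QStepsN G ψ P.N := (qStepsN_runX hstep hnL c₀ hL hσ hκL).mono hPN
  have hU1 : (1 : ℤ) ≤ (shearUnit nL hL : ℤ) := by have := shearUnit_pos hnL hL; omega
  have hU : (shearUnit nL hL : ℤ) ≤ ((kq + 1 : ℕ) : ℤ) * nL := by
    have : ((shearUnit nL hL : ℕ) : ℤ) = nL + (hL.natAbs : ℤ) := by unfold shearUnit; push_cast; ring
    rw [this]; push_cast
    have : (hL.natAbs : ℤ) ≤ kq * nL := by exact_mod_cast hκL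
    linarith
  have haff : ∀ (i : Fin 2) (σ₀ : ℤˣ), (SF i σ₀).IsAffine (shearUnit nL hL : ℤ) (if i = 0 then (shearUnit nL hL : ℤ) else nL) := fun i σ₀ => by
    rw [hSF]; exact runXSideU_isAffine c₀ hnL hL hσ _ _ i σ₀
  have hC : ∀ (i : Fin 2) (σ₀ : ℤˣ), (nL : ℤ) ≤ (if i = 0 then (shearUnit nL hL : ℤ) else nL) := fun i σ₀ => by
    split_ifs
    · have : ((shearUnit nL hL : ℕ) : ℤ) = nL + (hL.natAbs : ℤ) := by unfold shearUnit; push_cast; ring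
      rw [this]; linarith [Int.natCast_nonneg hL.natAbs]
    · exact le_rfl
  have hKC := hKC_of_affine SF haff hU1 P hnL hC hU hA hKCmax
  refine kitClause_runXFC hlipφ hstep hΔ hδ hnL c₀ hL hσ hκL P hPN hA hdD hDρ hKCmax hwide hdw hDw hT hr₀ hR hrs hcS Rg hRg hRgcard
    hcU1 Λc kz hΛRg hzconn hcz kk o Sfin hXD hN hk (fun x hx hfar => ?_) (fun x hx hnear => ?_)
  · -- FAR: the inner neighbour lies in the level and outside `B(w₀, R − r₀)`
    refine hfarT _ ?_ hfar
    have h := inNbr_spec (G := G) (φ := ψ) (by rw [hKeq] at hx; exact hx)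
    rw [hKeq]
    exact (mem_Win G ψ).2 ⟨h.2.1, h.2.2⟩
  · -- NEAR: the route datum at the kit centre from the long link (the zone-box disjunction's second branch)
    refine Or.inr ?_
    have hx' : x ∈ outerBoundary (winGraph G w₀ R) (Win G ψ w₀ (Finset.Icc (SN.lo k - (j : Site 2)) (SN.hi k + (j : Site 2))) R) := by
      rw [hKeq] at hx; exact hx
    set c := ctColEnd G SF P w₀ R x with hc
    -- the centre's frame image and window position
    have hcI : ψ c ∈ Finset.Icc (SN.lo k - ((SN.R' : ℕ) : Site 2)) (SN.hi k + ((SN.R' : ℕ) : Site 2)) :=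
      ψ_ctColEnd_mem_Icc SF hlip hq hstep hwide (fun i σ₀ z h1 h2 => hKC i σ₀ z h1) hE hx
    have hcw : c ∈ graphBall G w₀ (R - r) := by
      have hd := ctColEnd_reach SF hlip hq hstep hwide (fun i σ₀ z h1 h2 => hKC i σ₀ z h1) hx'
      have h := BoxProdZ2.mem_graphBall_add G hnear hd
      exact graphBall_mono G _ (by omega) h
    obtain ⟨Qt, Ft, hFT, hQD, -, hlt⟩ := routeSetsN_x (φ := φ) hnL c₀ hL hσ ℓL R's qB Nr hcI hcw hr hrR (Z := ∅) (Mz := 0) (by simp) hnL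
      hPD hPT hWD (hlong c _ (ChainPara.RunPrm.steer_eq_or _ _ _))
    exact ⟨Qt, Ft, hFT, hQD, hlt.le⟩

/-- **THE FORCED KIT CLAUSE OF A y′-RUN LEVEL FROM THE LONG LINKS AT EVERY CENTRE** (`hkits` of `kitsAt_stepAFF` at level `j` of step `k`;
the (S0) twin of `hkits_runYG`/`hkits_runY'`): window `runY φ c₀ n_L h_L σ`, level box `[lo k − j, hi k + j]` of `yRunSched … R′ qB Nr`
(`|v_L| ≤ n_L`, layer inequality, clearance `(Mz+4)(n_L+|h_L|) ≤ n_L(ℓ_L+1)`), region `Dr ⊇ Win(region k)` with the subbox weighting `Wt`, target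
`T ⊇ Win(core (k+1)) ∪ (far part of the level)`; the zone datum at the kit centres; input at every centre `c`: the LONG y′-links (top pieces
`σ`, `τ = ±1`, split `v_L`) at accuracy `δ³` (route datum by `routeSetsN_y`).
[cite: KozmaNitzan2024, §4 Lemma 10 (pp. 17–21)] [cite: MartineauTassion2017, §4.3 Lemma 4.2] [this work] -/
theorem hkits_runYFC [Countable V] (hlipφ : Lip G φ) (hstep : Steps G φ) {Δ : ℕ} (hΔ : ∀ v, G.degree v ≤ Δ) {q : unitInterval} {δ : ℝ} (hδ : 0 < δ)
    -- the run: long data, frame, schedule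
    {nL : ℕ} (hnL : 1 ≤ nL) (c₀ : V) (hL : ℤ) {σ : ℤ} (hσ : σ = 1 ∨ σ = -1) {kq : ℕ} (hκL : hL.natAbs ≤ kq * nL) {ℓL : ℕ} {vL : ℤ} (hvL : |vL| ≤ nL)
    (hlay : (nL + hL.natAbs : ℕ) ≤ (nL : ℤ) * ℓL + 1) (R's qB Nr : ℕ)
    {k j : ℕ} {w₀ : V} {R r Rl : ℕ}
    -- kit constants
    (P : ApronPrm) {Mz Rs KCmax rs cS cU : ℕ} (hPN : kq + 3 ≤ P.N) (hA : P.A = (Mz + 1 : ℕ) * (shearUnit nL hL : ℤ) + 1)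
    (hdD : P.d + 2 ≤ shellD P) (hDρ : Rs + 1 ≤ shellD P) (hKCmax : (shellD P + Mz + 1) * (kq + 1) ≤ KCmax)
    (hwide : ∀ i, ((yRunSched hnL hvL hlay R's qB Nr).lo k - (j : Site 2)) i + 2 * tanOff P.ℓs P.M ≤ ((yRunSched hnL hvL hlay R's qB Nr).hi k + (j : Site 2)) i)
    (hdw : ∀ i, ((yRunSched hnL hvL hlay R's qB Nr).lo k - (j : Site 2)) i + (P.d + 2 : ℕ) ≤ ((yRunSched hnL hvL hlay R's qB Nr).hi k + (j : Site 2)) i)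
    (hDw : ∀ i, ((yRunSched hnL hvL hlay R's qB Nr).lo k - (j : Site 2)) i + ((shellD P + 1 + P.d + KCmax + Rs : ℕ) : ℤ) ≤
      ((yRunSched hnL hvL hlay R's qB Nr).hi k + (j : Site 2)) i)
    (hT : (shellD P : ℤ) + KCmax + Rs ≤ tanOff P.ℓs P.M)
    (hr₀ : P.N * (tanOff P.ℓs P.M + 2) + P.N * P.d + (KCmax + Rs) ≤ P.r₀) (hR : P.r₀ ≤ R)
    (hrs : 1 + (P.N * (tanOff P.ℓs P.M + 2) + P.N * P.d + (KCmax + Rs)) ≤ rs)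
    (hcS : (P.N + 1) * (tanOff P.ℓs P.M + 1) + (P.N + 1) * P.d + (KCmax + 1) + cU ≤ cS)
    -- the reach of the kit centre: inside the `R′`-enlargement, and `B(w₀, R − r)` with `Rl ≤ r ≤ R`
    (hE : j + (P.N * (tanOff P.ℓs P.M + 1) + P.N * P.d + KCmax) ≤ (yRunSched hnL hvL hlay R's qB Nr).R')
    (hreach : r + (P.N * (tanOff P.ℓs P.M + 1) + P.N * P.d + KCmax) ≤ P.r₀) (hr : Rl ≤ r) (hrR : r ≤ R)
    -- the short region and the zone datum at the kit centres (inside `Rg`, connected from the centre inside itself, containing the centre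
    -- and the fat-prism zone box of record `cylBallFin c kz Rk`, `Rk ≥ cylRadMax types kz (2·KCmax)` — whence the forced column's end)
    (Rg : V → Finset V) (hRg : ∀ c, ∀ u ∈ Rg c, u ∈ graphBall G c Rs) (hRgcard : ∀ c, (Rg c).card ≤ cU) (hcU1 : 1 ≤ cU)
    (Λc : V → ℕ → Finset V) (kz : ℕ) (hΛRg : ∀ c, Λc c kz ⊆ Rg c) (hzconn : ∀ c, ∀ s ∈ Λc c kz, PathIn G (↑(Λc c kz) : Set V) c s)
    (hcz : ∀ c, c ∈ Λc c kz)


    (hclear : (Mz + 4) * (nL + hL.natAbs) ≤ nL * (ℓL + 1))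
    -- the level's source/support, the weighting on the region, the target
    (kk : ℕ) (o : V) (Sfin : Finset V) {Wt : Sym2 V → unitInterval} {Dr T : Finset V} (hWD : IsSubbox (winGraph G w₀ R) Wt q Dr)
    (hPD : Win G (runY φ c₀ nL hL σ) w₀ ((yRunSched hnL hvL hlay R's qB Nr).region k) R ⊆ Dr)
    (hXD : winLevel G (runY φ c₀ nL hL σ) w₀ R ((yRunSched hnL hvL hlay R's qB Nr).lo k) ((yRunSched hnL hvL hlay R's qB Nr).hi k) j ⊆ Dr)
    (hPT : Win G (runY φ c₀ nL hL σ) w₀ ((yRunSched hnL hvL hlay R's qB Nr).core (k + 1)) R ⊆ T)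
    (hfarT : ∀ v ∈ winLevel G (runY φ c₀ nL hL σ) w₀ R ((yRunSched hnL hvL hlay R's qB Nr).lo k) ((yRunSched hnL hvL hlay R's qB Nr).hi k) j,
      v ∉ graphBall G w₀ (R - P.r₀) → v ∈ T)
    {N : ℕ} (hN : kk * (Δ + 1) ^ (2 * rs) ≤ N) (hk : (1 - (q : ℝ) ^ (1 + Δ * cS + cS * cU)) ^ kk ≤ δ)
    -- THE INPUT AT EVERY CENTRE: the long links at accuracy `δ³`
    (hlong : ∀ c (τ : ℤ), τ = 1 ∨ τ = -1 → 1 - δ ^ 3 < (bondPercolation G q).real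
      (linkIn (pgramPrism G φ c nL hL (3 * ℓL) Rl) (Λc c kz) (pgTopPieceW G φ c nL hL ℓL Rl σ τ vL))) :
    ∃ (σ' : SData V) (S : Finset V),
      SHyp (winLData G (runY φ c₀ nL hL σ) w₀ R ((yRunSched hnL hvL hlay R's qB Nr).lo k) ((yRunSched hnL hvL hlay R's qB Nr).hi k) o Sfin) j σ' ∧
      σ'.N ≤ N ∧ (1 - (q : ℝ) ^ σ'.sB) ^ σ'.k ≤ δ ∧ S ⊆ Dr ∧ (∀ x ∈ σ'.K, σ'.face x ⊆ S) ∧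
      RelayClause (winLData G (runY φ c₀ nL hL σ) w₀ R ((yRunSched hnL hvL hlay R's qB Nr).lo k) ((yRunSched hnL hvL hlay R's qB Nr).hi k) o Sfin) Wt j σ' S T Dr δ := by
  set SN := yRunSched hnL hvL hlay R's qB Nr with hSN
  set ψ := runY φ c₀ nL hL σ with hψ
  set SF := runYSideU (φ := φ) c₀ hnL hL hσ (SN.lo k - (j : Site 2)) (SN.hi k + (j : Site 2)) with hSF
  have hKeq : winLevel G ψ w₀ R (SN.lo k) (SN.hi k) j = Win G ψ w₀ (Finset.Icc (SN.lo k - (j : Site 2)) (SN.hi k + (j : Site 2))) R := rfl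
  -- the frame facts used for the reach
  have hlip : Lip G ψ := lip_runY hlipφ hσ hnL c₀ hL
  have hq : QStepsN G ψ P.N := (qStepsN_runY hstep hnL c₀ hL hσ hκL).mono hPN
  have hU1 : (1 : ℤ) ≤ (shearUnit nL hL : ℤ) := by have := shearUnit_pos hnL hL; omega
  have hU : (shearUnit nL hL : ℤ) ≤ ((kq + 1 : ℕ) : ℤ) * nL := by
    have : ((shearUnit nL hL : ℕ) : ℤ) = nL + (hL.natAbs : ℤ) := by unfold shearUnit; push_cast; ring
    rw [this]; push_cast
    have : (hL.natAbs : ℤ) ≤ kq * nL := by exact_mod_cast hκL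
    linarith
  have haff : ∀ (i : Fin 2) (σ₀ : ℤˣ), (SF i σ₀).IsAffine (shearUnit nL hL : ℤ) (if i = 0 then (nL : ℤ) else (shearUnit nL hL : ℤ)) := fun i σ₀ => by
    rw [hSF]; exact runYSideU_isAffine c₀ hnL hL hσ _ _ i σ₀
  have hC : ∀ (i : Fin 2) (σ₀ : ℤˣ), (nL : ℤ) ≤ (if i = 0 then (nL : ℤ) else (shearUnit nL hL : ℤ)) := fun i σ₀ => by
    split_ifs
    · exact le_rfl
    · have : ((shearUnit nL hL : ℕ) : ℤ) = nL + (hL.natAbs : ℤ) := by unfold shearUnit; push_cast; ring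
      rw [this]; linarith [Int.natCast_nonneg hL.natAbs]
  have hKC := hKC_of_affine SF haff hU1 P hnL hC hU hA hKCmax
  refine kitClause_runYFC hlipφ hstep hΔ hδ hnL c₀ hL hσ hκL P hPN hA hdD hDρ hKCmax hwide hdw hDw hT hr₀ hR hrs hcS Rg hRg hRgcard
    hcU1 Λc kz hΛRg hzconn hcz kk o Sfin hXD hN hk (fun x hx hfar => ?_) (fun x hx hnear => ?_)
  · -- FAR: the inner neighbour lies in the level and outside `B(w₀, R − r₀)`
    refine hfarT _ ?_ hfar
    have h := inNbr_spec (G := G) (φ := ψ) (by rw [hKeq] at hx; exact hx)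
    rw [hKeq]
    exact (mem_Win G ψ).2 ⟨h.2.1, h.2.2⟩
  · -- NEAR: the route datum at the kit centre from the long link (the zone-box disjunction's second branch)
    refine Or.inr ?_
    have hx' : x ∈ outerBoundary (winGraph G w₀ R) (Win G ψ w₀ (Finset.Icc (SN.lo k - (j : Site 2)) (SN.hi k + (j : Site 2))) R) := by
      rw [hKeq] at hx; exact hx
    set c := ctColEnd G SF P w₀ R x with hc
    -- the centre's frame image and window position
    have hcI : ψ c ∈ Finset.Icc (SN.lo k - ((SN.R' : ℕ) : Site 2)) (SN.hi k + ((SN.R' : ℕ) : Site 2)) :=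
      ψ_ctColEnd_mem_Icc SF hlip hq hstep hwide (fun i σ₀ z h1 h2 => hKC i σ₀ z h1) hE hx
    have hcw : c ∈ graphBall G w₀ (R - r) := by
      have hd := ctColEnd_reach SF hlip hq hstep hwide (fun i σ₀ z h1 h2 => hKC i σ₀ z h1) hx'
      have h := BoxProdZ2.mem_graphBall_add G hnear hd
      exact graphBall_mono G _ (by omega) h
    obtain ⟨Qt, Ft, hFT, hQD, -, hlt⟩ := routeSetsN_y (φ := φ) hnL hvL hlay c₀ hσ R's qB Nr hcI hcw hr hrR (Z := ∅) (Mz := Mz) (by simp)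
      hclear hPD hPT hWD (hlong c _ (ChainPara.RunPrm.steer_eq_or _ _ _))
    exact ⟨Qt, Ft, hFT, hQD, hlt.le⟩

end Skelφ

end Summit.CriticalPhenomena.PercolationContinuityZ3.Theorems.Transplant

end
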